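import Literature.AlgebraicGeometry.Motives.HypersurfaceFieldPoints
import Literature.AlgebraicGeometry.Motives.ProjectiveSpaceFieldPointsFunctorial
import Literature.AlgebraicGeometry.Motives.ClosedSubvarietyOfPoint
import Literature.AlgebraicGeometry.Motives.RuledSurfaceRelation
import Literature.AlgebraicGeometry.Motives.VerticalLimitsOfLines
import Literature.AlgebraicGeometry.Motives.SubschemeCyclesDimProofs
import HarnessLib

/-!
# The base of the product trick: the closure of a rational point over a function field

For a `k`-scheme `Y` and a `K`-point `Q ∈ Y(K)` (`K ⊇ k` a field), let `T = closure {Q} ⊆ Y`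
(`ClosedSubvariety.ofPoint`, an integral closed subscheme, as a `k`-scheme through `Y`). When `Q` is
"birational onto `T`" — the local ring of `Y` at the image point surjects onto `K`
(`𝒪_{Y,Q} ↠ K`, e.g. when some projection of `Q` is the generic point `Spec κ(z) → X` of a
subvariety) — we prove:

* `exists_generic_lift` — `Q` lifts to `τ : Spec K → T` hitting the generic point;
* `exists_ringEquiv_functionField_of_surjective` — an isomorphism `e : k(T) ≅ K` of `k`-algebras
  with `Spec K ≅ Spec k(T) → T` the generic point (`Spec.map e ≫ qgen T = τ`);
* `height_genericPoint_eq_toENat_trdeg` — `dim T = trdeg_k K`;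
* `qgen_comp_eq_pointOfVec` — for a `k`-morphism `g : Y → ℙᵐ` with `g(Q) = [v]`, the generic
  point of `T` maps to `[e⁻¹ ∘ v]` (naturality of homogeneous coordinates,
  `pointOfVec_left_comp_algHom`).

This is the base `T` of the product-trick argument for `2`-cycles (closure of
`(γ, [u ∧ r], [x₀ ∧ r])` in `X × ℙ^𝐍 × ℙ^𝐍`). Everything is proved; no definitions.

## References

* [Hartshorne1977] R. Hartshorne, *Algebraic Geometry*, II Ex. 2.7, Ex. 3.11, Ex. 2.14.
* [GortzWedhorn2020] U. Görtz, T. Wedhorn, *Algebraic Geometry I*, 2nd ed., Thm. 5.22, Prop. 3.33.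
-/

noncomputable section

open CategoryTheory CategoryTheory.Limits AlgebraicGeometry MvPolynomial TopologicalSpace Opposite Order

universe u

namespace Literature.AlgebraicGeometry.Motives

attribute [local instance] MvPolynomial.gradedAlgebra ProjFamily.functionFieldAlgebra

namespace ProjFamily

variable {k : Type u} [Field k] (Y : SchemeOver k) {K : Type u} [Field K] [Algebra k K]
  (Q : AlgPoints Y K)

/-- **A `K`-point lifts to the closure of its image, at the generic point.** [folklore] -/
theorem exists_generic_lift :
    ∃ τ : Spec (CommRingCat.of K) ⟶ (ClosedSubvariety.ofPoint Y.left Q.pt).carrier,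
      τ ≫ (ClosedSubvariety.ofPoint Y.left Q.pt).ι = Q.left ∧
      τ ≫ ((ClosedSubvariety.ofPoint Y.left Q.pt).ι ≫ Y.hom) =
        Spec.map (CommRingCat.ofHom (algebraMap k K)) ∧
      τ.base (IsLocalRing.closedPoint K) = genericPoint (ClosedSubvariety.ofPoint Y.left Q.pt).carrier := by
  set T := ClosedSubvariety.ofPoint Y.left Q.pt with hT
  let TO : SchemeOver k := Over.mk (T.ι ≫ Y.hom)
  let j : TO ⟶ Y := Over.homMk T.ι rfl
  haveI : IsClosedImmersion j.left := inferInstanceAs (IsClosedImmersion T.ι)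
  have hmem : Q.pt ∈ Set.range j.left.base := by
    change Q.pt ∈ Set.range T.ι.base
    rw [ClosedSubvariety.range_ofPoint_ι]
    exact subset_closure rfl
  let τ : AlgPoints TO K := Q.liftClosed j hmem
  have hτ : τ ≫ j = Q := AlgPoints.map_liftClosed j Q hmem
  have hτ1 : τ.left ≫ T.ι = Q.left := congrArg CommaMorphism.left hτ
  refine ⟨τ.left, hτ1, Over.w τ, ?_⟩
  apply T.ι_base_injective
  change (τ.left ≫ T.ι).base (IsLocalRing.closedPoint K) = T.genericPoint
  rw [ClosedSubvariety.genericPoint_ofPoint]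
  change _ = Q.left.base (IsLocalRing.closedPoint K)
  rw [hτ1]

/-- **`k(T) ≅ K` for the closure `T` of a birational `K`-point.** If `𝒪_{Y,Q} → K` is onto, there
is a ring isomorphism `e : k(T) ≃ K` compatible with the `k`-structures, through which the lift
`τ : Spec K → T` of `Q` is the generic point: `Spec.map e ≫ qgen T = τ`, `τ ≫ ι_T = Q`.
[cite: Hartshorne1977, II Ex. 2.7] -/
theorem exists_ringEquiv_functionField_of_surjective
    (hQ : Function.Surjective (Scheme.stalkClosedPointTo Q.left)) :
    ∃ (τ : Spec (CommRingCat.of K) ⟶ (ClosedSubvariety.ofPoint Y.left Q.pt).carrier)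
      (e : (Over.mk ((ClosedSubvariety.ofPoint Y.left Q.pt).ι ≫ Y.hom) : SchemeOver k).left.functionField ≃+* K),
      τ ≫ (ClosedSubvariety.ofPoint Y.left Q.pt).ι = Q.left ∧
      τ ≫ ((ClosedSubvariety.ofPoint Y.left Q.pt).ι ≫ Y.hom) =
        Spec.map (CommRingCat.ofHom (algebraMap k K)) ∧
      τ.base (IsLocalRing.closedPoint K) = genericPoint (ClosedSubvariety.ofPoint Y.left Q.pt).carrier ∧
      Spec.map (CommRingCat.ofHom e.toRingHom) ≫
        qgen (Over.mk ((ClosedSubvariety.ofPoint Y.left Q.pt).ι ≫ Y.hom) : SchemeOver k) = τ ∧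
      ∀ c : k, e (algebraMap k _ c) = algebraMap k K c := by
  obtain ⟨τ, hτ1, hτk, hτη⟩ := exists_generic_lift Y Q
  -- the two specialisations between `τ pt` and the generic point
  have h₁ : τ.base (IsLocalRing.closedPoint K) ⤳ genericPoint (ClosedSubvariety.ofPoint Y.left Q.pt).carrier := by rw [hτη]
  have h₂ : genericPoint (ClosedSubvariety.ofPoint Y.left Q.pt).carrier ⤳ τ.base (IsLocalRing.closedPoint K) := by rw [hτη]
  -- `e₀ : k((ClosedSubvariety.ofPoint Y.left Q.pt)) → K`
  let s₁ := (ClosedSubvariety.ofPoint Y.left Q.pt).carrier.presheaf.stalkSpecializes h₁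
  let s₂ := (ClosedSubvariety.ofPoint Y.left Q.pt).carrier.presheaf.stalkSpecializes h₂
  have hs12 : s₁ ≫ s₂ = 𝟙 _ := by
    rw [TopCat.Presheaf.stalkSpecializes_comp]; exact TopCat.Presheaf.stalkSpecializes_refl _ _
  have hs21 : s₂ ≫ s₁ = 𝟙 _ := by
    rw [TopCat.Presheaf.stalkSpecializes_comp]; exact TopCat.Presheaf.stalkSpecializes_refl _ _
  let e₀ : (Over.mk ((ClosedSubvariety.ofPoint Y.left Q.pt).ι ≫ Y.hom) : SchemeOver k).left.functionField ⟶ CommRingCat.of K := s₁ ≫ Scheme.stalkClosedPointTo τ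
  -- `Spec.map e₀ ≫ qgen = τ`
  have hgen : Spec.map e₀ ≫ qgen (Over.mk ((ClosedSubvariety.ofPoint Y.left Q.pt).ι ≫ Y.hom) : SchemeOver k) = τ := by
    change Spec.map (s₁ ≫ Scheme.stalkClosedPointTo τ) ≫ (ClosedSubvariety.ofPoint Y.left Q.pt).carrier.fromSpecStalk (genericPoint (ClosedSubvariety.ofPoint Y.left Q.pt).carrier) = τ
    rw [Spec.map_comp, Category.assoc, Scheme.SpecMap_stalkSpecializes_fromSpecStalk,
      Scheme.Spec_stalkClosedPointTo_fromSpecStalk]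
  -- bijectivity
  have hsurjτ : Function.Surjective (Scheme.stalkClosedPointTo τ) := by
    have h := hQ
    rw [← hτ1, Scheme.stalkClosedPointTo_comp] at h
    exact Function.Surjective.of_comp (by
      intro y; obtain ⟨x, hx⟩ := h y; exact ⟨_, hx⟩)
  have hsurj : Function.Surjective e₀ := by
    intro y
    obtain ⟨x, hx⟩ := hsurjτ y
    refine ⟨s₂ x, ?_⟩
    have hss : s₁ (s₂ x) = x := by
      change (s₂ ≫ s₁) x = x
      rw [hs21]; rfl
    change Scheme.stalkClosedPointTo τ (s₁ (s₂ x)) = y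
    rw [hss]; exact hx
  have hbij : Function.Bijective e₀.hom := ⟨e₀.hom.injective, hsurj⟩
  let e : (Over.mk ((ClosedSubvariety.ofPoint Y.left Q.pt).ι ≫ Y.hom) : SchemeOver k).left.functionField ≃+* K := RingEquiv.ofBijective e₀.hom hbij
  refine ⟨τ, e, hτ1, hτk, hτη, hgen, fun c => ?_⟩
  -- `k`-compatibility: the value of the structure constant `c` at the `K`-point `τ` is `c`
  let τ' : AlgPoints (Over.mk ((ClosedSubvariety.ofPoint Y.left Q.pt).ι ≫ Y.hom) : SchemeOver k) K := AlgPoints.mk τ hτk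
  have hsc : SchemeOver.scalarRingHom (Over.mk ((ClosedSubvariety.ofPoint Y.left Q.pt).ι ≫ Y.hom) : SchemeOver k) ⊤ c =
      (Over.mk ((ClosedSubvariety.ofPoint Y.left Q.pt).ι ≫ Y.hom) : SchemeOver k).hom.appTop ((Scheme.ΓSpecIso (.of k)).inv c) := by
    rw [SchemeOver.scalarRingHom_apply]
    exact (CategoryTheory.congr_fun (Scheme.Hom.app_eq_appLE
      ((Over.mk ((ClosedSubvariety.ofPoint Y.left Q.pt).ι ≫ Y.hom) : SchemeOver k).hom) (U := ⊤)) _).symm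
  have hev := AlgPoints.eval_scalarRingHom τ' (U := ⊤) trivial c
  rw [hsc] at hev
  -- `e (algebraMap c) = τ'.eval ⊤ (T.hom^* c)`
  change Scheme.stalkClosedPointTo τ (s₁ ((ClosedSubvariety.ofPoint Y.left Q.pt).carrier.presheaf.germ ⊤ (genericPoint (ClosedSubvariety.ofPoint Y.left Q.pt).carrier) trivial
    ((Over.mk ((ClosedSubvariety.ofPoint Y.left Q.pt).ι ≫ Y.hom) : SchemeOver k).hom.appTop ((Scheme.ΓSpecIso (.of k)).inv c)))) = algebraMap k K c
  rw [← hev]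
  change _ = Scheme.stalkClosedPointTo τ ((ClosedSubvariety.ofPoint Y.left Q.pt).carrier.presheaf.germ ⊤ (τ.base (IsLocalRing.closedPoint K)) trivial
    ((Over.mk ((ClosedSubvariety.ofPoint Y.left Q.pt).ι ≫ Y.hom) : SchemeOver k).hom.appTop ((Scheme.ΓSpecIso (.of k)).inv c)))
  congr 1
  rw [← CategoryTheory.comp_apply, TopCat.Presheaf.germ_stalkSpecializes]

/-- **`dim T = trdeg_k K`** for the closure `T` of a birational `K`-point (`Y` locally of finite
type over `k`): the lift `τ : Spec K → T` is a preimmersion at the generic point, and the dimension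
of a point is the transcendence degree of its residue field. [cite: GortzWedhorn2020, Thm. 5.22] -/
theorem height_genericPoint_ofPoint_eq_toENat_trdeg [LocallyOfFiniteType Y.hom]
    (hQ : Function.Surjective (Scheme.stalkClosedPointTo Q.left)) :
    height (genericPoint (ClosedSubvariety.ofPoint Y.left Q.pt).carrier) = Cardinal.toENat (Algebra.trdeg k K) := by
  obtain ⟨τ, hτ1, hτk, hτη⟩ := exists_generic_lift Y Q
  -- `τ` is a preimmersion
  have hsurjτ : Function.Surjective (Scheme.stalkClosedPointTo τ) := by
    have h := hQ
    rw [← hτ1, Scheme.stalkClosedPointTo_comp] at h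
    exact Function.Surjective.of_comp (by
      intro y; obtain ⟨x, hx⟩ := h y; exact ⟨_, hx⟩)
  haveI : SurjectiveOnStalks τ := by
    refine ⟨fun x => ?_⟩
    have hx : x = IsLocalRing.closedPoint K := Subsingleton.elim (α := PrimeSpectrum K) _ _
    subst hx
    intro y
    obtain ⟨a, ha⟩ := hsurjτ ((stalkClosedPointIso (CommRingCat.of K)).hom y)
    refine ⟨a, ?_⟩
    apply (stalkClosedPointIso (CommRingCat.of K)).commRingCatIsoToRingEquiv.injective
    exact ha
  haveI hpre : IsPreimmersion τ :=
    IsPreimmersion.mk (toSurjectiveOnStalks := inferInstance) (Topology.IsEmbedding.of_subsingleton _)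
  haveI : @IsPreimmersion (Spec (CommRingCat.of K)) (Over.mk ((ClosedSubvariety.ofPoint Y.left Q.pt).ι ≫ Y.hom) : SchemeOver k).left τ := hpre
  haveI : LocallyOfFiniteType (Over.mk ((ClosedSubvariety.ofPoint Y.left Q.pt).ι ≫ Y.hom) : SchemeOver k).hom :=
    inferInstanceAs (LocallyOfFiniteType ((ClosedSubvariety.ofPoint Y.left Q.pt).ι ≫ Y.hom))
  have h := Scheme.height_eq_toENat_trdeg_of_isPreimmersion (Over.mk ((ClosedSubvariety.ofPoint Y.left Q.pt).ι ≫ Y.hom) : SchemeOver k).hom τ hτk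
  refine Eq.trans ?_ h
  congr 1
  exact hτη.symm

/-- The closure of a `K`-point in a proper `k`-scheme is proper over `k`. [folklore] -/
theorem isProper_ofPoint [IsProper Y.hom] : IsProper (Over.mk ((ClosedSubvariety.ofPoint Y.left Q.pt).ι ≫ Y.hom) : SchemeOver k).hom :=
  inferInstanceAs (IsProper ((ClosedSubvariety.ofPoint Y.left Q.pt).ι ≫ Y.hom))

/-- **Homogeneous coordinates of the generic point along a morphism to `ℙᵐ`.** With `τ, e` as in
`exists_ringEquiv_functionField_of_surjective` (`Spec.map e ≫ qgen T = τ`, `τ ≫ ι_T = Q`, `e` a map of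
`k`-algebras) and a `k`-morphism `g : Y → ℙᵐ_k` with `g(Q) = [v]`: the generic point of `T` maps to
the `k(T)`-point `[e⁻¹ ∘ v]`. [cite: Hartshorne1977, II Ex. 2.14] -/
theorem qgen_comp_eq_pointOfVec
    {τ : Spec (CommRingCat.of K) ⟶ (ClosedSubvariety.ofPoint Y.left Q.pt).carrier}
    {e : (Over.mk ((ClosedSubvariety.ofPoint Y.left Q.pt).ι ≫ Y.hom) : SchemeOver k).left.functionField ≃+* K}
    (hτ1 : τ ≫ (ClosedSubvariety.ofPoint Y.left Q.pt).ι = Q.left)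
    (hgen : Spec.map (CommRingCat.ofHom e.toRingHom) ≫ qgen (Over.mk ((ClosedSubvariety.ofPoint Y.left Q.pt).ι ≫ Y.hom) : SchemeOver k) = τ)
    (hek : ∀ c : k, e (algebraMap k _ c) = algebraMap k K c)
    {m : ℕ} (g : Y ⟶ projectiveSpace m k) {v : Fin (m + 1) → K} (hv0 : v ≠ 0)
    (hv : Q ≫ g = ProjectiveSpace.pointOfVec k v hv0) :
    ∃ h0 : (fun j => e.symm (v j)) ≠ 0,
      qgen (Over.mk ((ClosedSubvariety.ofPoint Y.left Q.pt).ι ≫ Y.hom) : SchemeOver k) ≫ ((ClosedSubvariety.ofPoint Y.left Q.pt).ι ≫ g.left) = (ProjectiveSpace.pointOfVec k (fun j => e.symm (v j)) h0).left := by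
  -- `e⁻¹` as a map of `k`-algebras
  let φ : K →ₐ[k] (Over.mk ((ClosedSubvariety.ofPoint Y.left Q.pt).ι ≫ Y.hom) : SchemeOver k).left.functionField :=
    { e.symm.toRingHom with
      commutes' := fun c => by
        change e.symm (algebraMap k K c) = algebraMap k _ c
        rw [← hek c, RingEquiv.symm_apply_apply] }
  have h0 : (φ ∘ v) ≠ 0 := ProjectiveSpace.comp_ne_zero φ hv0
  refine ⟨h0, ?_⟩
  -- `qgen = Spec.map e⁻¹ ≫ τ`
  have hcomp : CommRingCat.ofHom e.toRingHom ≫ CommRingCat.ofHom e.symm.toRingHom = 𝟙 _ := by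
    ext a; exact e.symm_apply_apply a
  have h1 : Spec.map (CommRingCat.ofHom e.symm.toRingHom) ≫ Spec.map (CommRingCat.ofHom e.toRingHom) = 𝟙 _ := by
    rw [← Spec.map_comp, hcomp, Spec.map_id]
  have hq : Spec.map (CommRingCat.ofHom e.symm.toRingHom) ≫ τ =
      qgen (Over.mk ((ClosedSubvariety.ofPoint Y.left Q.pt).ι ≫ Y.hom) : SchemeOver k) := by
    rw [← hgen]
    exact (reassoc_of% h1) _
  have hτg : τ ≫ (ClosedSubvariety.ofPoint Y.left Q.pt).ι ≫ g.left = (Q ≫ g).left := by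
    rw [← Category.assoc, hτ1]; rfl
  have key : Spec.map (CommRingCat.ofHom e.symm.toRingHom) ≫
      (τ ≫ (ClosedSubvariety.ofPoint Y.left Q.pt).ι ≫ g.left) =
        (ProjectiveSpace.pointOfVec k (fun j => e.symm (v j)) h0).left := by
    rw [hτg, hv]
    exact (ProjectiveSpace.pointOfVec_left_comp_algHom φ v hv0).symm
  rw [← hq]
  exact (Category.assoc _ _ _).trans key

end ProjFamily

end Literature.AlgebraicGeometry.Motives

end
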